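import Literature.Computability.AlgebraicComplexity.StrongUSP
import HarnessLib

/-!
# ω-census, family (b1) USP / strong USP: the weighted (fractional) piece-count bound on the size of a USP

HONEST FRAMING (pub-omega census; verbatim): lottery ticket; floor = certified bounds/negative ranges.
Census BOOKKEEPING for the `(size, width)` table of uniquely solvable puzzles (Cohn–Kleinberg–Szegedy–Umans 2005
§3; Anderson–Ji–Xu 2020 Tables 1–2).  Plain USPs carry no bound on `ω`; nothing in this file touches `ω`.

## The bound
For a USP `U ⊆ {1,2,3}^k` and a symbol `e`, the `e`-pieces `{i : uᵢ = e}` of distinct rows are distinct (AJX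
Lemma 6, tree `IsUSP.uspPiece_injective`).  Hence for every symbol `e` and every size `c`, AT MOST `binom(k,c)` rows
have an `e`-piece of size `c` (`IsUSP.card_filter_uspPiece_le_choose`).  The three piece sizes of a row sum to `k`,
so for any weight `w : ℕ → ℕ` and any `B` with `B ≤ w c₁ + w c₂ + w c₃` whenever `c₁ + c₂ + c₃ = k`, summing over
rows and then over symbols gives the MASTER INEQUALITY (`IsUSP.mul_card_le_weighted`)

  `B · s ≤ 3 · Σ_{c ≤ k} w(c) · binom(k, c)`.

This is the linear-programming dual of maximising the number of rows subject to the eighteen "per symbol, per size"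
injectivity constraints; Anderson–Ji–Xu's §5 Proposition 2 ("USP bound": `Σ_{c₁+c₂≤k} min binom`, tree
`IsUSP.card_le_uspSizeBound`) and the "unique pieces bound" `2^k` (tree `IsUSP.card_le_two_pow`) are the two
weaker relaxations that keep, respectively, only one profile at a time or only one size class at a time.  The printed
list of SUSP upper bounds (AJX §5: ω bound, unique pieces, USP bound, clique bound, exhaustive, downward-closure
lift; Table 2) does not contain this bound; at width 5 the three piece-counting values are `45` (Prop. 2), `32`
(unique pieces) and `17` (this file).

## Values landed here (all by `omega` from the master inequality with an explicit weight)
* `IsUSP.card_le_17_of_width_five`: weight `(3,2,1,0,0,0)`, `B = 4`: `4s ≤ 3·(3 + 10 + 10) = 69`, so `s ≤ 17`.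
  The kernel range of the width-5 USP cell becomes `[14, 17]` (tree `isUSP_14_5`; previous upper half
  `IsUSP.card_le_21_of_width_five`, the slice lift of `s_max^USP(4) = 7`).
* `IsUSP.card_le_30_of_width_six` (weight `(3,2,1,0,…)`, `B = 3`: `3s ≤ 90`) and the strong form
  `IsStrongUSP.card_le_30_of_width_six` (kernel had `≤ 45` via `3·15`; print: `24` by the downward-closure lift of the
  exhaustive `s_max^SUSP(5) = 8`, which is not a kernel theorem); width-6 USP kernel range `[21, 30]` (tree `isUSP_21_6`).
* `IsUSP.card_le_55_of_width_seven` (weight `(2,2,1,0,…)`, `B = 2`: `2s ≤ 111`); width-7 USP kernel range `[28, 55]`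
  (tree `isUSP_28_7`).
The integer optimum of the full eighteen-constraint program at width 5 is also `17` (engine check,
`HOME/pub-omega-stpp-1-g6/code/piece_ip5.py`), so `17` is everything piece counting alone can give at width 5.

References: Cohn–Kleinberg–Szegedy–Umans, FOCS 2005 (arXiv:math/0511460) §3, Lemma 3.2 / 12; Anderson–Ji–Xu, SAT 2020
(arXiv:2301.00074v1) §3.5 Lemma 6, §5 Proposition 2 and the list of bounds there.
-/

namespace Summit.MatrixMultiplication.OmegaCensus

open Literature.Computability.AlgebraicComplexity Finset

variable {s k : ℕ}

/-- The three pieces of a row partition its `k` columns: `|piece₁| + |piece₂| + |piece₃| = k`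
(re-proved here; the Literature copy is file-private). [folklore] -/
theorem card_uspPiece_add (row : Fin s → Fin k → Fin 3) (u : Fin s) :
    (uspPiece row 0 u).card + (uspPiece row 1 u).card + (uspPiece row 2 u).card = k := by
  classical
  have h := Finset.card_eq_sum_card_fiberwise (s := (univ : Finset (Fin k))) (t := (univ : Finset (Fin 3)))
    (f := row u) (fun i _ => Finset.mem_univ _)
  rw [Finset.card_univ, Fintype.card_fin, Fin.sum_univ_three] at h
  simpa [uspPiece, add_assoc] using h.symm

/-- **Per-symbol, per-size injectivity count**: in a USP, for each symbol `a` and each size `c` at most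
`binom(k, c)` rows have an `a`-piece of size `c` — the `a`-piece map is injective (AJX Lemma 6) into the
`c`-subsets of the `k` columns. [cite: AndersonJiXu2020, Lemma 6 (arXiv:2301.00074v1 §3.5)] -/
theorem IsUSP.card_filter_uspPiece_le_choose {row : Fin s → Fin k → Fin 3} (h : IsUSP row) (a : Fin 3)
    (c : ℕ) : (univ.filter fun u : Fin s => (uspPiece row a u).card = c).card ≤ k.choose c := by
  classical
  have hc := Finset.card_le_card_of_injOn (uspPiece row a)
    (s := univ.filter fun u : Fin s => (uspPiece row a u).card = c)
    (t := powersetCard c (univ : Finset (Fin k)))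
    (fun u hu => Finset.mem_coe.2 (Finset.mem_powersetCard.2
        ⟨Finset.subset_univ _, (Finset.mem_filter.1 (Finset.mem_coe.1 hu)).2⟩))
    ((h.uspPiece_injective a).injOn)
  simpa [Finset.card_powersetCard] using hc

/-- **Weighted count for one symbol**: `Σ_u w(|piece_a(u)|) ≤ Σ_{c ≤ k} w(c)·binom(k,c)` for a USP (group the rows
by the size of their `a`-piece and apply the injectivity count to each group). [folklore] -/
theorem IsUSP.sum_weight_uspPiece_le {row : Fin s → Fin k → Fin 3} (h : IsUSP row) (w : ℕ → ℕ) (a : Fin 3) :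
    ∑ u : Fin s, w (uspPiece row a u).card ≤ ∑ c ∈ range (k + 1), w c * k.choose c := by
  classical
  have hmaps : ∀ u ∈ (univ : Finset (Fin s)), (uspPiece row a u).card ∈ range (k + 1) := by
    intro u _
    have hle : (uspPiece row a u).card ≤ k := by
      simpa using Finset.card_le_univ (uspPiece row a u)
    exact Finset.mem_range.2 (Nat.lt_succ_of_le hle)
  rw [← Finset.sum_fiberwise_of_maps_to hmaps]
  refine Finset.sum_le_sum fun c _ => ?_
  have hconst : ∑ u ∈ univ.filter (fun u : Fin s => (uspPiece row a u).card = c), w (uspPiece row a u).card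
      = (univ.filter (fun u : Fin s => (uspPiece row a u).card = c)).card * w c := by
    rw [Finset.sum_congr rfl (fun u hu => by rw [(Finset.mem_filter.1 hu).2]), Finset.sum_const, smul_eq_mul]
  rw [hconst, mul_comm]
  exact Nat.mul_le_mul_left _ (IsUSP.card_filter_uspPiece_le_choose h a c)

/-- **The weighted (fractional) piece-count bound, master inequality.**  If `w : ℕ → ℕ` and `B` satisfy
`B ≤ w c₁ + w c₂ + w c₃` for every split `c₁ + c₂ + c₃ = k` of the `k` columns into three piece sizes, then every
USP of `s` rows and width `k` has `B · s ≤ 3 · Σ_{c ≤ k} w(c)·binom(k,c)`.  (LP dual of the per-symbol/per-size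
injectivity constraints; AJX Prop. 2 and the `2^k` bound are special cases.) [folklore] -/
theorem IsUSP.mul_card_le_weighted {row : Fin s → Fin k → Fin 3} (h : IsUSP row) (w : ℕ → ℕ) (B : ℕ)
    (hB : ∀ c₁ c₂ c₃ : ℕ, c₁ + c₂ + c₃ = k → B ≤ w c₁ + w c₂ + w c₃) :
    B * s ≤ 3 * ∑ c ∈ range (k + 1), w c * k.choose c := by
  classical
  have h0 := IsUSP.sum_weight_uspPiece_le h w 0
  have h1 := IsUSP.sum_weight_uspPiece_le h w 1
  have h2 := IsUSP.sum_weight_uspPiece_le h w 2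
  calc B * s = ∑ _u : Fin s, B := by simp [mul_comm]
    _ ≤ ∑ u : Fin s, (w (uspPiece row 0 u).card + w (uspPiece row 1 u).card + w (uspPiece row 2 u).card) :=
        Finset.sum_le_sum fun u _ => hB _ _ _ (card_uspPiece_add row u)
    _ = (∑ u : Fin s, w (uspPiece row 0 u).card) + (∑ u : Fin s, w (uspPiece row 1 u).card) +
          ∑ u : Fin s, w (uspPiece row 2 u).card := by
        rw [Finset.sum_add_distrib, Finset.sum_add_distrib]
    _ ≤ 3 * ∑ c ∈ range (k + 1), w c * k.choose c := by omega

/-- The same master inequality for strong USPs (every strong USP is a USP).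
[cite: CohnKleinbergSzegedyUmans2005, §3 (p. 5)] -/
theorem IsStrongUSP.mul_card_le_weighted {row : Fin s → Fin k → Fin 3} (h : IsStrongUSP row) (w : ℕ → ℕ)
    (B : ℕ) (hB : ∀ c₁ c₂ c₃ : ℕ, c₁ + c₂ + c₃ = k → B ≤ w c₁ + w c₂ + w c₃) :
    B * s ≤ 3 * ∑ c ∈ range (k + 1), w c * k.choose c :=
  IsUSP.mul_card_le_weighted h.isUSP w B hB

/-- **No USP of width 5 has more than 17 rows**: weight `(3,2,1,0,0,0)` on piece sizes, `B = 4` (every split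
`c₁ + c₂ + c₃ = 5` has weight `≥ 4`), so `4s ≤ 3·(3·1 + 2·5 + 1·10) = 69`.  Census cell: USP width 5 is now the kernel range
`[14, 17]` (`isUSP_14_5` in the tree; previous kernel upper half `21`). Not in print (AJX tabulate strong USPs only; their §5
bounds give `32`/`45` here). [folklore] -/
theorem IsUSP.card_le_17_of_width_five {row : Fin s → Fin 5 → Fin 3} (h : IsUSP row) : s ≤ 17 := by
  have hm := IsUSP.mul_card_le_weighted h (fun c => if c = 0 then 3 else if c = 1 then 2 else if c = 2 then 1 else 0) 4
    (by intro c₁ c₂ c₃ hs; split_ifs <;> omega)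
  have hv : ∑ c ∈ range (5 + 1), (fun c : ℕ => if c = 0 then 3 else if c = 1 then 2 else if c = 2 then 1 else 0) c
      * Nat.choose 5 c = 23 := by decide
  rw [hv] at hm
  omega

/-- **No USP of width 6 has more than 30 rows**: weight `(3,2,1,0,…)`, `B = 3`, `3s ≤ 3·(3 + 12 + 15) = 90`.  Census cell: USP
width 6 kernel range `[21, 30]` (`isUSP_21_6` in the tree; previous kernel upper half `3·21 = 63`). [folklore] -/
theorem IsUSP.card_le_30_of_width_six {row : Fin s → Fin 6 → Fin 3} (h : IsUSP row) : s ≤ 30 := by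
  have hm := IsUSP.mul_card_le_weighted h (fun c => if c = 0 then 3 else if c = 1 then 2 else if c = 2 then 1 else 0) 3
    (by intro c₁ c₂ c₃ hs; split_ifs <;> omega)
  have hv : ∑ c ∈ range (6 + 1), (fun c : ℕ => if c = 0 then 3 else if c = 1 then 2 else if c = 2 then 1 else 0) c
      * Nat.choose 6 c = 30 := by decide
  rw [hv] at hm
  omega

/-- **No strong USP of width 6 has more than 30 rows** — kernel improvement of the tree's `≤ 45`
(`IsStrongUSP.card_le_15_of_width_five` lifted by `3`); the printed value is `24` (AJX Table 2: downward-closure lift of the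
exhaustive `s_max^SUSP(5) = 8`, not a kernel theorem), the conjectured truth `14` (AJX §7.1). [folklore] -/
theorem IsStrongUSP.card_le_30_of_width_six {row : Fin s → Fin 6 → Fin 3} (h : IsStrongUSP row) : s ≤ 30 :=
  IsUSP.card_le_30_of_width_six h.isUSP

/-- **No USP of width 7 has more than 55 rows**: weight `(2,2,1,0,…)`, `B = 2`, `2s ≤ 3·(2 + 14 + 21) = 111`.  Census cell:
USP width 7 kernel range `[28, 55]` (`isUSP_28_7` in the tree). [folklore] -/
theorem IsUSP.card_le_55_of_width_seven {row : Fin s → Fin 7 → Fin 3} (h : IsUSP row) : s ≤ 55 := by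
  have hm := IsUSP.mul_card_le_weighted h (fun c => if c = 0 then 2 else if c = 1 then 2 else if c = 2 then 1 else 0) 2
    (by intro c₁ c₂ c₃ hs; split_ifs <;> omega)
  have hv : ∑ c ∈ range (7 + 1), (fun c : ℕ => if c = 0 then 2 else if c = 1 then 2 else if c = 2 then 1 else 0) c
      * Nat.choose 7 c = 37 := by decide
  rw [hv] at hm
  omega

/-- The strong form at width 7: no strong USP of width 7 has more than 55 rows (bookkeeping; AJX Table 2's clique bound at
width 7 is smaller, and the largest known strong USP of width 7 has 23 rows). [folklore] -/
theorem IsStrongUSP.card_le_55_of_width_seven {row : Fin s → Fin 7 → Fin 3} (h : IsStrongUSP row) : s ≤ 55 :=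
  IsUSP.card_le_55_of_width_seven h.isUSP

end Summit.MatrixMultiplication.OmegaCensus
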